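import Mathlib
import Literature.NumberTheory.LFunctions.Zhang2022.SkeletonObjects
import HarnessLib

/-!
# Zhang (2022), §16 p. 94: the identity `1 ∗ χτ₂ = ν ∗ χ` — kernel-checked

Topic `Literature/NumberTheory/LFunctions/Zhang2022` (Landau–Siegel audit tree; verdict-neutral).
Y. Zhang, *Discrete mean estimates and the Landau–Siegel zero*, arXiv:2211.02515v1 (2022)
[Zhang2022LandauSiegel] — **an unrefereed manuscript under adjudication**. §16 p. 94 (tex L4634,
DAG node `Z22:(16.15)`, the in-line identity preceding (16.15), typed as
`Typed.Section16B.OneConvChiTau2`):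

> Since `1∗χτ₂ = ν∗χ` (here `1` denotes the arithmetic function identically equal to `1`), …

PROVED here in the skeleton's vocabulary (`ν = Skeleton.nu χ = 1 ∗ χ`, the tree's `divisorSumChar`;
`∗` = `LSeries.convolution`): `one_conv_chi_tau2`. The proof: `χ` is completely multiplicative, so
`χ·τ₂ = χ·(1∗1) = χ∗χ` (`toArithmeticFunction_chi_mul_card_divisors`), whence
`1∗χτ₂ = 1∗χ∗χ = ν∗χ` by associativity. The one-line transfer to the typed node lives in
`Section16Eval1617Typed`. Nothing else of §16 is asserted; nothing about Theorems 1–2 of the source.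

## References

* Y. Zhang, arXiv:2211.02515v1 (2022), §16 p. 94, (16.15). [cite: Zhang2022LandauSiegel, §16 (16.15)]
-/

noncomputable section

open Complex

namespace Literature.NumberTheory.LFunctions.Zhang2022.Skeleton

/-! ## `1 ∗ χτ₂ = ν ∗ χ` -/

section Identity

variable {D : ℕ} (χ : DirichletCharacter ℂ D)

/-- For a Dirichlet character (completely multiplicative): the arithmetic function
`n ↦ χ(n)τ₂(n)` is the Dirichlet square of `n ↦ χ(n)`: `Σ_{ab=n} χ(a)χ(b) = χ(n)·#{(a,b) : ab = n}`.
[folklore] -/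
private theorem toArithmeticFunction_chi_mul_card_divisors :
    toArithmeticFunction (fun m : ℕ => χ (m : ZMod D) * (m.divisors.card : ℂ)) =
      toArithmeticFunction (fun m : ℕ => χ (m : ZMod D)) *
        toArithmeticFunction (fun m : ℕ => χ (m : ZMod D)) := by
  ext m
  by_cases hm : m = 0
  · subst hm; simp [toArithmeticFunction]
  · simp only [toArithmeticFunction, ArithmeticFunction.coe_mk, hm, if_false,
      ArithmeticFunction.mul_apply]
    have hconst : ∀ x ∈ m.divisorsAntidiagonal,
        (if x.1 = 0 then (0 : ℂ) else χ (x.1 : ZMod D)) * (if x.2 = 0 then 0 else χ (x.2 : ZMod D)) =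
          χ (m : ZMod D) := by
      intro x hx
      obtain ⟨hx1, hx2⟩ := Nat.ne_zero_of_mem_divisorsAntidiagonal hx
      rw [if_neg hx1, if_neg hx2, ← map_mul, ← Nat.cast_mul, (Nat.mem_divisorsAntidiagonal.mp hx).1]
    rw [Finset.sum_congr rfl hconst, Finset.sum_const, ← Nat.map_div_right_divisors, Finset.card_map,
      nsmul_eq_mul, mul_comm]

/-- `ν = 1 ∗ χ` as arithmetic functions (`Skeleton.nu χ = divisorSumChar χ`). [folklore] -/
private theorem toArithmeticFunction_nu :
    toArithmeticFunction (nu χ) =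
      ((ArithmeticFunction.zeta : ArithmeticFunction ℕ) : ArithmeticFunction ℂ) *
        toArithmeticFunction (fun m : ℕ => χ (m : ZMod D)) := by
  ext m
  by_cases hm : m = 0
  · subst hm; simp [toArithmeticFunction]
  · simp only [toArithmeticFunction, ArithmeticFunction.coe_mk, hm, if_false]
    exact divisorSumChar_eq_zeta_mul χ m

/-- The constant function `1` is the arithmetic function `ζ`. [folklore] -/
private theorem toArithmeticFunction_one :
    toArithmeticFunction (fun _ : ℕ => (1 : ℂ)) =
      ((ArithmeticFunction.zeta : ArithmeticFunction ℕ) : ArithmeticFunction ℂ) := by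
  ext m
  by_cases hm : m = 0
  · subst hm; simp [toArithmeticFunction]
  · simp [toArithmeticFunction, ArithmeticFunction.natCoe_apply, ArithmeticFunction.zeta_apply, hm]

/-- **"Since `1∗χτ₂ = ν∗χ` (here `1` denotes the arithmetic function identically equal to `1`)"**
(§16 p. 94, tex L4634, DAG `Z22:(16.15)`; the content of `Typed.Section16B.OneConvChiTau2`), PROVED:
`(1 ∗ χτ₂)(n) = (ν ∗ χ)(n)` for every `n` (`ν = 1∗χ = Skeleton.nu χ`; both sides are
`(ζ ∗ χ ∗ χ)(n)` by associativity, `χτ₂ = χ ∗ χ`). [cite: Zhang2022LandauSiegel, §16 (16.15) p.94] -/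
theorem one_conv_chi_tau2 (n : ℕ) :
    LSeries.convolution (fun _ => (1 : ℂ)) (fun m => χ (m : ZMod D) * (m.divisors.card : ℂ)) n =
      LSeries.convolution (nu χ) (fun m => χ (m : ZMod D)) n := by
  simp only [LSeries.convolution]
  rw [toArithmeticFunction_one, toArithmeticFunction_chi_mul_card_divisors, toArithmeticFunction_nu,
    mul_assoc]

end Identity

end Literature.NumberTheory.LFunctions.Zhang2022.Skeleton
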